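import Mathlib.Combinatorics.SetFamily.HarrisKleitman
import Mathlib.Data.Finset.Sups
import HarnessLib

/-!
# `NoHeavyLowerTail` (crux stmt-CriticalPhenomena-4575), master-family hierarchy P3: the `k = 2` row of the comb hierarchy is a
# THEOREM — the two-copy fibre sums of Sahi's `E₂` (the covariance) are nonnegative, by two applications of Harris–Kleitman

Support file (seat `prim-masterthm-p3`; `--supports stmt-CriticalPhenomena-4575`).  Companion of `…ThreePartitionAD` (`k = 3`,
`ThreePartitionPositivity`, OPEN) and `…SahiC4CombStatement` (`k = 4`, `SahiE4CombPositivity`, OPEN); here `k = 2` is proved for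
every finite ground set.

The statement.  For up-sets `𝒰, 𝒱` of the cube `2^α` the degree-2 tensor-Bernstein coefficient of
`p ↦ μ_p(𝒰 ∩ 𝒱) − μ_p(𝒰)μ_p(𝒱)` at a profile `j ∈ {0,1,2}^α` is the TWO-COPY FIBRE SUM over pairs of configurations
`(ω¹, ω²)` with `ω¹_e + ω²_e = j_e` of `[ω¹ ∈ 𝒰 ∩ 𝒱] − [ω¹ ∈ 𝒰][ω² ∈ 𝒱]` (run/shared/lean/prim/prim-masterthm/prim-masterthm-p3/HIERARCHY.md
§1).  Coordinates with `j_e ∈ {0,2}` are fixed in both copies (pass to the sections, again up-sets); on the split coordinates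
`J = {j_e = 1}` the pair is `(S, J ∖ S)`, so the fibre sum is

  `N₂(𝒰', 𝒱') = #{S : S ∈ 𝒰' ∩ 𝒱'} − #{S ∈ 𝒰' : Sᶜ ∈ 𝒱'} = #(𝒰' ∩ 𝒱') − #(𝒰' ∩ 𝒱'ᶜˢ)`   (`twoPartN`; `𝒱'ᶜˢ` = complements of members)

for the sections `𝒰', 𝒱' ⊆ 2^J`.  **`twoPartN_nonneg`**: `N₂ ≥ 0` for all up-sets — Harris–Kleitman twice
(`#𝒰·#𝒱 ≤ 2^n·#(𝒰 ∩ 𝒱)` for two up-sets, `2^n·#(𝒰 ∩ 𝒱ᶜˢ) ≤ #𝒰·#𝒱ᶜˢ = #𝒰·#𝒱` for an up-set and the down-set `𝒱ᶜˢ`; Mathlib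
`IsUpperSet.le_card_inter_finset`, `IsUpperSet.card_inter_le_finset`).  So (M⁺-2) — "Sahi's `E₂` sits at the top corner
`(r,c) = (|E|, 2)` of the comb lattice" — holds on every finite cube; the formal bridge "fibre sum = `twoPartN` of the sections"
is bookkeeping not done in this file (as for `k = 3` in `…ThreePartitionAD`).  Nothing is asserted about the crux.
-/

namespace Summit.CriticalPhenomena.PercolationContinuityZ3.Theorems.TwoPartition

open Finset
open scoped FinsetFamily

variable {α : Type*} [DecidableEq α] [Fintype α]

/-- The two-partition functional `N₂(𝒰,𝒱) = #(𝒰 ∩ 𝒱) − #(𝒰 ∩ 𝒱ᶜˢ)` (= the two-copy fibre sum of `E₂` on the all-split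
profile). [this work] -/
def twoPartN (𝒰 𝒱 : Finset (Finset α)) : ℤ := (#(𝒰 ∩ 𝒱) : ℤ) - #(𝒰 ∩ 𝒱ᶜˢ)

omit [Fintype α] in
/-- Membership form of the subtracted count: `𝒰 ∩ 𝒱ᶜˢ = {S ∈ 𝒰 : Sᶜ ∈ 𝒱}` (ordered 2-partitions `(S, Sᶜ)` with `S ∈ 𝒰`,
`Sᶜ ∈ 𝒱`). [this work] -/
theorem inter_compls_eq_filter [Fintype α] (𝒰 𝒱 : Finset (Finset α)) :
    𝒰 ∩ 𝒱ᶜˢ = 𝒰.filter fun S => Sᶜ ∈ 𝒱 := by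
  ext S
  simp [mem_compls]

omit [DecidableEq α] in
/-- The complements of the members of an up-set form a down-set. [folklore] -/
theorem isLowerSet_compls [DecidableEq α] {𝒱 : Finset (Finset α)} (h : IsUpperSet (𝒱 : Set (Finset α))) :
    IsLowerSet ((𝒱ᶜˢ : Finset (Finset α)) : Set (Finset α)) := by
  intro s t hts hs
  rw [Finset.mem_coe, Finset.mem_compls] at hs ⊢
  exact h (compl_le_compl hts) hs

/-- **The `k = 2` row of the comb hierarchy** (this work): `N₂(𝒰,𝒱) ≥ 0` for all up-sets `𝒰, 𝒱` of a finite cube — two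
applications of the Harris–Kleitman inequality. [this work] -/
theorem twoPartN_nonneg {𝒰 𝒱 : Finset (Finset α)} (h𝒰 : IsUpperSet (𝒰 : Set (Finset α)))
    (h𝒱 : IsUpperSet (𝒱 : Set (Finset α))) : 0 ≤ twoPartN 𝒰 𝒱 := by
  have h1 : #𝒰 * #𝒱 ≤ 2 ^ Fintype.card α * #(𝒰 ∩ 𝒱) := h𝒰.le_card_inter_finset h𝒱
  have h2 : 2 ^ Fintype.card α * #(𝒰 ∩ 𝒱ᶜˢ) ≤ #𝒰 * #𝒱ᶜˢ := h𝒰.card_inter_le_finset (isLowerSet_compls h𝒱)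
  rw [card_compls] at h2
  have h3 : 2 ^ Fintype.card α * #(𝒰 ∩ 𝒱ᶜˢ) ≤ 2 ^ Fintype.card α * #(𝒰 ∩ 𝒱) := h2.trans h1
  have h4 : #(𝒰 ∩ 𝒱ᶜˢ) ≤ #(𝒰 ∩ 𝒱) := Nat.le_of_mul_le_mul_left h3 (Nat.two_pow_pos _)
  unfold twoPartN
  omega

/-- The same with the subtracted count written as `#{S ∈ 𝒰 : Sᶜ ∈ 𝒱}`. [this work] -/
theorem card_filter_compl_mem_le_card_inter {𝒰 𝒱 : Finset (Finset α)} (h𝒰 : IsUpperSet (𝒰 : Set (Finset α)))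
    (h𝒱 : IsUpperSet (𝒱 : Set (Finset α))) : #(𝒰.filter fun S => Sᶜ ∈ 𝒱) ≤ #(𝒰 ∩ 𝒱) := by
  have h := twoPartN_nonneg h𝒰 h𝒱
  unfold twoPartN at h
  rw [inter_compls_eq_filter] at h
  omega

end Summit.CriticalPhenomena.PercolationContinuityZ3.Theorems.TwoPartition
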